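/- Width seat `ym-line-cbag-p1-w2` (prover-ym-line-cbag-p1-w2-g15-0; own items stmt-QuantumFields-22254 / 22893 CLOSED) on the
planner-of-record's LINE 4, route `U1DipoleHelicity`, crux `WilsonU1DipoleLawD4` (stmt-QuantumFields-25880): the free-boundary
spin-wave kernel of Fröhlich–Spencer's duality on the cube `B_{2n+1}` converges, at rate `n⁻⁴`, to the route's photon kernel
`freeK = curvatureTwoPoint` — by identifying the Villain exact-part bilinear form with the tree's comb-gauge box projection kernel
`WeakCouplingRates.boxProjKernel` and importing the S4 estimate of crux `ColdBoxTwoPointFloorW`.  Helper `--supports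
stmt-QuantumFields-25880`; no stub is closed here.  Nothing in this file bears on the Yang–Mills mass gap. -/
import Summits.QuantumFields.YangMills.Theorems.U1DipoleHelicityVillainPlaqCorrDuality
import Summits.QuantumFields.YangMills.Theorems.U1DipoleHelicityFreeKCurvatureTwoPoint
import Summits.QuantumFields.YangMills.Theorems.WeakCouplingRatesBoxCutoff
import Summits.QuantumFields.YangMills.Theorems.WeakCouplingRatesCurvatureKernel
import HarnessLib

/-!
# Crux `WilsonU1DipoleLawD4` (stmt-QuantumFields-25880): the free-boundary spin-wave kernel of the Villain cube converges to `freeK`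

In the dual form of the Villain two-plaquette function (`villainPlaqCorr_eq_spinWave_gas`) the Gaussian data are the spin-wave energies
`E_n(δ_p)`, `E_n(δ_q)` and the bilinear form `B_n(p,q) = (Tᵀδ_p)·(M⁻¹Tᵀδ_q)` of the exact part (`T = dMat`, the coboundary from the free
axial-gauge link angles of `B_{2n+1}` to its plaquettes, `M = TᵀT`).  This file proves that these converge to the infinite-lattice
photon kernel:

* `villainBilin_eq_boxProjKernel` (**the bridge**): `B_{2H+1}(p,q) = WeakCouplingRates.boxProjKernel H p q` — the Villain exact-part
  form on the cube `halfOpenBox 4 (2H+1)` IS the comb-gauge projection kernel of the free-boundary lattice Maxwell box of side `2H+1`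
  (same free edges `{e ∈ boxEdges, e ∉ comb}` up to the trivial translation `boxEdgesAt 0`, same circulation vectors, same Gram matrix);
* `exists_abs_villainBilin_sub_curvatureTwoPoint_le`: `|B_{2n+1}(p,q) − curvatureTwoPoint p q| ≤ K/n⁴` for `n ≥ 32` and `p, q` within
  sup-distance `n/8` of the centre (the S4 estimate `exists_boxProjKernel_sub_curl_bound` + `curvatureTwoPoint_eq_curl_greenTensor`);
* `exists_villainKernel_freeK_bound`: for the plaquettes `p = (n𝟙;0,1)`, `q = (z+n𝟙;0,1)` of stub 1:
  `|B_{2n+1}(p,q) − freeK z| ≤ K/n⁴`, `|E_{2n+1}(δ_p) − 1/2| ≤ K/n⁴`, `|E_{2n+1}(δ_q) − 1/2| ≤ K/n⁴` for `n ≥ max 32 (8‖z‖_∞)`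
  (`freeK = curvatureTwoPoint`, `curvatureTwoPoint_self = 2/d = 1/2`).

Hence the pure spin-wave value `e^{−(E_p+E_q)/2βV} sinh(B/βV)` of the cube tends to `e^{−K(0)/βV} sinh(K(z)/βV)` as `n → ∞` for every
`z` (next file: the stub-1-shaped Gaussian calibration of the cube).  RECORD-type material on an abelian comparison line; the Yang–Mills mass
gap is NOT proved by anything here.
-/

set_option autoImplicit false

noncomputable section

namespace Summit.QuantumFields.YangMills.Theorems.U1DipoleHelicity

open Finset
open scoped Real Matrix
open Literature.Probability.LatticeModels Literature.MathematicalPhysics.QuantumLattice Literature.MathematicalPhysics.QuantumFieldTheory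
open Literature.MathematicalPhysics.QuantumFieldTheory.VillainAngle
open Literature.MathematicalPhysics.QuantumFieldTheory.AxialGauge
open Literature.MathematicalPhysics.QuantumFieldTheory.LatticeMaxwell (coeff coeffAux Qmat)
open Literature.Probability.LatticeModels.GaussianCoord (gram exactPart perpPart exactEnergy)
open Summit.QuantumFields.YangMills.Theorems.WeakCouplingRates (boxProjKernel boxCentre greenTensor boxQmat_eq_sum
  exists_boxProjKernel_sub_curl_bound curvatureTwoPoint_eq_curl_greenTensor)

/-! ### The bridge: Villain exact-part form = comb-gauge box projection kernel -/

/-- The extension by zero of the indicator of a free edge is the indicator edge function. [folklore] -/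
theorem extAngle_single {n : ℕ} (f : FIdx 4 n) (x : Literature.Probability.LatticeModels.Site 4) (i : Fin 4) :
    extAngle (Pi.single f (1 : ℝ) : FIdx 4 n → ℝ) x i = if (x, i) = f.1.1 then 1 else 0 := by
  unfold extAngle
  by_cases h : (x, i) ∈ boxEdges 4 n
  · rw [dif_pos h]
    by_cases hc : IsComb (x, i)
    · rw [dif_pos hc, if_neg]
      intro hxi
      exact f.2 (hxi ▸ hc)
    · rw [dif_neg hc, Pi.single_apply]
      congr 1
      apply propext
      constructor
      · intro hh; rw [← hh]
      · intro hh
        exact Subtype.ext (Subtype.ext hh)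
  · rw [dif_neg h, if_neg]
    intro hxi
    exact h (hxi ▸ f.1.2)

/-- **The coboundary matrix entries are the circulation coefficients**: `T_{p,f} = coeffAux f p` (the coefficient of the free edge `f`
in the circulation around the plaquette `p`). [folklore] -/
theorem dMat_apply_eq_coeffAux {n : ℕ} (p : PIdx 4 n) (f : FIdx 4 n) :
    dMat p f = coeffAux f.1.1 p.1 := by
  rw [dMat, LinearMap.toMatrix'_apply, dFreeR_apply]
  have h : LatticeForm.d₁ (extAngle (Pi.single f (1 : ℝ) : FIdx 4 n → ℝ)) p.1.1 p.1.2.1 p.1.2.2 =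
      LatticeMaxwell.sCirc (fun e : Literature.MathematicalPhysics.QuantumLattice.ZdEdge 4 => if e = f.1.1 then (1 : ℝ) else 0) p.1 := by
    rw [Summit.QuantumFields.YangMills.Theorems.WeakCouplingRates.sCirc_eq_d₁]
    congr 1
    funext x i
    exact extAngle_single f x i
  rw [h, LatticeMaxwell.sCirc, coeffAux]
  simp only [eq_comm]

/-- **The bridge.**  For the cube `B_{2H+1} = halfOpenBox 4 (2H+1)`, the Villain exact-part bilinear form of two indicator sheets is
the comb-gauge free-boundary box projection kernel of route `WeakCouplingRates`:
`(Tᵀδ_p)·(M⁻¹Tᵀδ_q) = boxProjKernel H p q`. [folklore] -/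
theorem villainBilin_eq_boxProjKernel (H : ℕ) (p q : PIdx 4 (2 * H + 1)) :
    (dMatᵀ *ᵥ (Pi.single p (1 : ℝ) : PIdx 4 (2 * H + 1) → ℝ)) ⬝ᵥ
        ((gram (dMat (d := 4) (n := 2 * H + 1)))⁻¹ *ᵥ (dMatᵀ *ᵥ (Pi.single q (1 : ℝ) : PIdx 4 (2 * H + 1) → ℝ))) =
      boxProjKernel H p.1 q.1 := by
  -- the identification of the free-edge index types
  have hmem : ∀ e : Literature.MathematicalPhysics.QuantumLattice.ZdEdge 4,
      e ∈ boxEdges 4 (2 * H + 1) ↔ e ∈ LatticeMaxwell.boxEdgesAt (0 : Literature.Probability.LatticeModels.Site 4) (2 * H + 1) :=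
    fun e => by rw [LatticeMaxwell.mem_boxEdgesAt, sub_zero]
  let ι : ↥(boxEdges 4 (2 * H + 1)) ≃ ↥(LatticeMaxwell.boxEdgesAt (0 : Literature.Probability.LatticeModels.Site 4) (2 * H + 1)) :=
    Equiv.subtypeEquivRight hmem
  let ε : FIdx 4 (2 * H + 1) ≃
      LatticeMaxwell.Free (AxialGauge.IsComb (d := 4)) (0 : Literature.Probability.LatticeModels.Site 4) (2 * H + 1) :=
    ι.subtypeEquiv fun e => Iff.rfl
  have hε : ∀ f : FIdx 4 (2 * H + 1), ((ε f).1 : Literature.MathematicalPhysics.QuantumLattice.ZdEdge 4) = f.1.1 := fun f => rfl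
  -- (a) matrix entries
  have hd : ∀ (r : PIdx 4 (2 * H + 1)) (f : FIdx 4 (2 * H + 1)),
      dMat r f = coeff IsComb (0 : Literature.Probability.LatticeModels.Site 4) (2 * H + 1) r.1 (ε f) := by
    intro r f
    rw [dMat_apply_eq_coeffAux]
    show coeffAux f.1.1 r.1 = coeffAux ((ε f).1 : Literature.MathematicalPhysics.QuantumLattice.ZdEdge 4) r.1
    rw [hε]
  -- (b) columns of `Tᵀ`
  have hcol : ∀ r : PIdx 4 (2 * H + 1), dMatᵀ *ᵥ (Pi.single r (1 : ℝ) : PIdx 4 (2 * H + 1) → ℝ) =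
      fun f => coeff IsComb (0 : Literature.Probability.LatticeModels.Site 4) (2 * H + 1) r.1 (ε f) := by
    intro r
    funext f
    rw [← hd r f]
    simp only [Matrix.mulVec, dotProduct, Matrix.transpose_apply, Pi.single_apply, mul_ite, mul_one, mul_zero,
      Finset.sum_ite_eq', Finset.mem_univ, if_true]
  -- (c) the Gram matrix is the reindexed precision matrix
  have hgram : gram (dMat (d := 4) (n := 2 * H + 1)) =
      (Qmat (AxialGauge.IsComb (d := 4)) (0 : Literature.Probability.LatticeModels.Site 4) (2 * H + 1)).submatrix ε ε := by
    ext f f'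
    have lhs : gram (dMat (d := 4) (n := 2 * H + 1)) f f' = ∑ r : PIdx 4 (2 * H + 1), dMat r f * dMat r f' := by
      rw [Literature.Probability.LatticeModels.GaussianCoord.gram, Matrix.mul_apply]
      rfl
    have rhs : ((Qmat (AxialGauge.IsComb (d := 4)) (0 : Literature.Probability.LatticeModels.Site 4) (2 * H + 1)).submatrix ε ε) f f' =
        ∑ r ∈ plaquettesIn (halfOpenBox 4 (2 * H + 1)),
          coeff IsComb (0 : Literature.Probability.LatticeModels.Site 4) (2 * H + 1) r (ε f) *
            coeff IsComb (0 : Literature.Probability.LatticeModels.Site 4) (2 * H + 1) r (ε f') := by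
      rw [Matrix.submatrix_apply, boxQmat_eq_sum H, Matrix.sum_apply]
      exact Finset.sum_congr rfl fun r _ => by rw [Matrix.vecMulVec_apply]
    rw [lhs, rhs, ← Finset.sum_coe_sort (plaquettesIn (halfOpenBox 4 (2 * H + 1)))]
    exact Finset.sum_congr rfl fun r _ => by rw [hd, hd]
  -- (d) assemble
  rw [hcol p, hcol q, hgram, Matrix.inv_submatrix_equiv, boxProjKernel]
  have hmv : ((Qmat (AxialGauge.IsComb (d := 4)) (0 : Literature.Probability.LatticeModels.Site 4) (2 * H + 1))⁻¹.submatrix ε ε) *ᵥ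
      (fun f => coeff IsComb (0 : Literature.Probability.LatticeModels.Site 4) (2 * H + 1) q.1 (ε f)) =
      fun f => ((Qmat (AxialGauge.IsComb (d := 4)) (0 : Literature.Probability.LatticeModels.Site 4) (2 * H + 1))⁻¹ *ᵥ
        coeff IsComb (0 : Literature.Probability.LatticeModels.Site 4) (2 * H + 1) q.1) (ε f) := by
    funext f
    simp only [Matrix.mulVec, dotProduct, Matrix.submatrix_apply]
    exact Equiv.sum_comp ε (fun g =>
      (Qmat (AxialGauge.IsComb (d := 4)) (0 : Literature.Probability.LatticeModels.Site 4) (2 * H + 1))⁻¹ (ε f) g *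
        coeff IsComb (0 : Literature.Probability.LatticeModels.Site 4) (2 * H + 1) q.1 g)
  rw [hmv]
  simp only [dotProduct]
  exact Equiv.sum_comp ε (fun g => coeff IsComb (0 : Literature.Probability.LatticeModels.Site 4) (2 * H + 1) p.1 g *
    ((Qmat (AxialGauge.IsComb (d := 4)) (0 : Literature.Probability.LatticeModels.Site 4) (2 * H + 1))⁻¹ *ᵥ
      coeff IsComb (0 : Literature.Probability.LatticeModels.Site 4) (2 * H + 1) q.1) g)

/-! ### The rate `n⁻⁴` towards `curvatureTwoPoint` -/

/-- **Free-boundary spin-wave kernel versus the `ℤ⁴` photon kernel, with rate.**  There is `K` such that for every `n ≥ 32` and all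
plaquettes `p, q` of `B_{2n+1}` based within sup-distance `n/8` of the centre `n𝟙`,
`|(Tᵀδ_p)·(M⁻¹Tᵀδ_q) − curvatureTwoPoint p q| ≤ K/n⁴` (S4 of crux `ColdBoxTwoPointFloorW` through the bridge). [folklore] -/
theorem exists_abs_villainBilin_sub_curvatureTwoPoint_le :
    ∃ K : ℝ, 0 ≤ K ∧ ∀ n : ℕ, (32 : ℝ) ≤ n → ∀ (p q : PIdx 4 (2 * n + 1)),
      ‖p.1.1 - boxCentre n‖ ≤ (n : ℝ) / 8 → ‖q.1.1 - boxCentre n‖ ≤ (n : ℝ) / 8 →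
        |(dMatᵀ *ᵥ (Pi.single p (1 : ℝ) : PIdx 4 (2 * n + 1) → ℝ)) ⬝ᵥ
            ((gram (dMat (d := 4) (n := 2 * n + 1)))⁻¹ *ᵥ (dMatᵀ *ᵥ (Pi.single q (1 : ℝ) : PIdx 4 (2 * n + 1) → ℝ))) -
          curvatureTwoPoint (d := 4) ⟨p.1.1, ⟨(p.1.2.1, p.1.2.2), (VillainFibre.mem_plaquettesIn_iff.1 p.2).1⟩⟩
            ⟨q.1.1, ⟨(q.1.2.1, q.1.2.2), (VillainFibre.mem_plaquettesIn_iff.1 q.2).1⟩⟩| ≤ K / (n : ℝ) ^ 4 := by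
  obtain ⟨K, hK0, hK⟩ := exists_boxProjKernel_sub_curl_bound
  refine ⟨K, hK0, fun n hn p q hp hq => ?_⟩
  rw [villainBilin_eq_boxProjKernel, curvatureTwoPoint_eq_curl_greenTensor]
  exact hK n hn p.1 q.1 p.2 q.2 hp hq

/-! ### The plaquettes of stub 1: `p = (n𝟙; 0,1)`, `q = (z + n𝟙; 0,1)` -/

/-- `‖(z + n𝟙) − n𝟙‖_∞ = ‖z‖_∞`. [folklore] -/
theorem norm_add_diag_sub_boxCentre (z : Literature.Probability.LatticeModels.Site 4) (n : ℕ) :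
    ‖z + diag 4 n - boxCentre n‖ = (Site.supNorm z : ℝ) := by
  have h : z + diag 4 n - boxCentre n = z := by
    funext i; simp [VillainAngle.diag, boxCentre]
  rw [h, Site.norm_eq_supNorm]

/-- **The Gaussian data of the Villain two-plaquette function converge to the photon kernel, with rate** `n⁻⁴`: for `p = (n𝟙;0,1)`,
`q = (z+n𝟙;0,1)` and `n ≥ max 32 (8‖z‖_∞)` (and `n ≥ ‖z‖_∞ + 1` for membership),
`|B_{2n+1}(p,q) − freeK z| ≤ K/n⁴`, `|E_{2n+1}(δ_p) − 1/2| ≤ K/n⁴`, `|E_{2n+1}(δ_q) − 1/2| ≤ K/n⁴`. [folklore] -/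
theorem exists_villainKernel_freeK_bound :
    ∃ K : ℝ, 0 ≤ K ∧ ∀ (z : Literature.Probability.LatticeModels.Site 4) (n : ℕ) (hn : Site.supNorm z + 1 ≤ n),
      (32 : ℝ) ≤ n → 8 * (Site.supNorm z : ℝ) ≤ n →
        |(dMatᵀ *ᵥ (Pi.single (⟨(diag 4 n, 0, 1), diag_mem_plaquettesIn (one_le_of_supNorm_succ_le z hn)⟩ :
              PIdx 4 (2 * n + 1)) (1 : ℝ) : PIdx 4 (2 * n + 1) → ℝ)) ⬝ᵥ
            ((gram (dMat (d := 4) (n := 2 * n + 1)))⁻¹ *ᵥ (dMatᵀ *ᵥ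
              (Pi.single (⟨(z + diag 4 n, 0, 1), add_diag_mem_plaquettesIn z hn⟩ : PIdx 4 (2 * n + 1)) (1 : ℝ) :
                PIdx 4 (2 * n + 1) → ℝ))) - freeK z| ≤ K / (n : ℝ) ^ 4 ∧
        |exactEnergy dMat (Pi.single (⟨(diag 4 n, 0, 1), diag_mem_plaquettesIn (one_le_of_supNorm_succ_le z hn)⟩ :
              PIdx 4 (2 * n + 1)) (1 : ℝ)) - 1 / 2| ≤ K / (n : ℝ) ^ 4 ∧
        |exactEnergy dMat (Pi.single (⟨(z + diag 4 n, 0, 1), add_diag_mem_plaquettesIn z hn⟩ : PIdx 4 (2 * n + 1)) (1 : ℝ)) -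
            1 / 2| ≤ K / (n : ℝ) ^ 4 := by
  obtain ⟨K, hK0, hK⟩ := exists_abs_villainBilin_sub_curvatureTwoPoint_le
  refine ⟨K, hK0, fun z n hn h32 h8 => ?_⟩
  have hn0 : (0 : ℝ) < n := by linarith
  have hp : ‖diag 4 n - boxCentre n‖ ≤ (n : ℝ) / 8 := by
    have h := norm_add_diag_sub_boxCentre 0 n
    rw [zero_add] at h
    rw [h]
    simp [Site.supNorm]
    positivity
  have hq : ‖z + diag 4 n - boxCentre n‖ ≤ (n : ℝ) / 8 := by
    rw [norm_add_diag_sub_boxCentre]; linarith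
  set p : PIdx 4 (2 * n + 1) := ⟨(diag 4 n, 0, 1), diag_mem_plaquettesIn (one_le_of_supNorm_succ_le z hn)⟩ with hpdef
  set q : PIdx 4 (2 * n + 1) := ⟨(z + diag 4 n, 0, 1), add_diag_mem_plaquettesIn z hn⟩ with hqdef
  have hpq := hK n h32 p q hp hq
  have hpp := hK n h32 p p hp hp
  have hqq := hK n h32 q q hq hq
  refine ⟨?_, ?_, ?_⟩
  · -- `curvatureTwoPoint p q = freeK z` (stationarity + `freeK_eq_curvatureTwoPoint`)
    have hshift := curvatureTwoPoint_shift (d := 4) ⟨0, ⟨((0 : Fin 4), (1 : Fin 4)), by decide⟩⟩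
      ⟨z, ⟨((0 : Fin 4), (1 : Fin 4)), by decide⟩⟩ (diag 4 n)
    simp only [zero_add] at hshift
    have hK' : curvatureTwoPoint (d := 4) ⟨p.1.1, ⟨(p.1.2.1, p.1.2.2), (VillainFibre.mem_plaquettesIn_iff.1 p.2).1⟩⟩
        ⟨q.1.1, ⟨(q.1.2.1, q.1.2.2), (VillainFibre.mem_plaquettesIn_iff.1 q.2).1⟩⟩ = freeK z := by
      rw [freeK_eq_curvatureTwoPoint, ← hshift]
    rw [← hK']
    exact hpq
  · have hK' : curvatureTwoPoint (d := 4) ⟨p.1.1, ⟨(p.1.2.1, p.1.2.2), (VillainFibre.mem_plaquettesIn_iff.1 p.2).1⟩⟩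
        ⟨p.1.1, ⟨(p.1.2.1, p.1.2.2), (VillainFibre.mem_plaquettesIn_iff.1 p.2).1⟩⟩ = 1 / 2 := by
      rw [curvatureTwoPoint_self (by norm_num)]; norm_num
    rw [← hK']
    exact hpp
  · have hK' : curvatureTwoPoint (d := 4) ⟨q.1.1, ⟨(q.1.2.1, q.1.2.2), (VillainFibre.mem_plaquettesIn_iff.1 q.2).1⟩⟩
        ⟨q.1.1, ⟨(q.1.2.1, q.1.2.2), (VillainFibre.mem_plaquettesIn_iff.1 q.2).1⟩⟩ = 1 / 2 := by
      rw [curvatureTwoPoint_self (by norm_num)]; norm_num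
    rw [← hK']
    exact hqq

end Summit.QuantumFields.YangMills.Theorems.U1DipoleHelicity

end
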